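import Mathlib
import HarnessLib
import Summits.NavierStokesRegularity.NavierStokesRegularity.Theorems.HalfSpaceWindowDoorCirculationCarryingRigidityGaussVorticityLaw

/-!
# Route `HalfSpaceWindowDoor`, crux `CirculationCarryingRigidity` (stmt-NavierStokesRegularity-25311) —
# the KINEMATIC INFLOW LAW: `σ ↦ ℐ(s₀−σ; x₀)[v(σ)]` is differentiable along every backward characteristic of the door class,
# with derivative = differentiation under the Gaussian integral (moving kernel + velocity rate `∂ₜv`)

LEAD ns-hsw-p1 g8 (cell pub-ns-dss), `--supports stmt-NavierStokesRegularity-25311 --as helper`; answers `Lines/blowdown.md` §Next (b)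
(«the INFLOW LAW `dℐ/ds` along characteristics, to write the second-order condition at the extremal point»).  The swirl law O1
(`gaussianSwirlLaw_holds`) gives `d𝒢/ds` in terms of the inflow correlation `ℐ`; the second-order condition at the Gaussian-extremal point
is a statement about `dℐ/ds`, which needs the VELOCITY rate `∂ₜv` (pressure enters through Navier–Stokes; here it is kept implicit in
`∂ₜv`, which on the class is bounded by `K/((−t)√(−t))`, `…ClassSpaceTimeRates.exists_deriv_rate_of_class`).  This file proves the
differentiation-under-the-integral statement, with absolutely convergent Gaussian integrals and no integration by parts:

* `gaussInflow_eq_integral_heatKernel` — `ℐ(t;x₀)[u] = (4π)^{3/2}∫G_t(x−x₀)·⟪x−x₀,u⟫·g` (`g = angMom x₀ u`);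
* `hasDerivAt_inner_mul_angMom` — the pointwise rate of `⟪x−x₀,v(σ,x)⟫·g(σ,x)` from the rate of `σ ↦ v(σ,x)`;
* `hasDerivAt_gaussInflowIntegral_time` — for a jointly smooth field on `(−∞,0)` with `v`, `∂ₜv` bounded on a time neighbourhood of
  `s`, and `s < s₀`:  `d/dσ|_{σ=s} ∫G_{s₀−σ}(x−x₀)⟪x−x₀,v(σ)⟫g(σ) = ∫[−(‖x−x₀‖²/4t² − 3/2t)G·⟪x−x₀,v⟫g + G·(⟪x−x₀,∂ₜv⟫g + ⟪x−x₀,v⟫ġ)]`,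
  `t = s₀−s`, `ġ = angMom x₀ (∂ₜv)` (dominated differentiation with the explicit majorant `‖x−x₀‖²e^{−‖x−x₀‖²/16t}`);
* `hasDerivAt_gaussInflow_of_class` — the same on the door class (Type-I rate, continuity, Oseen–Duhamel identity, divergence-free),
  for every axis datum `(x₀, s₀)` and every `s < min(0, s₀)`, with `∂ₜv = deriv (v · x)`, and the formula for
  `d/ds ℐ(s₀−s; x₀)[v(s)]` (`= (4π)^{3/2}` times the integral above).

WHAT THIS IS NOT: not a statement about Navier–Stokes regularity; door statements concern HYPOTHETICAL blow-up profiles (KNSS ancient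
mild solutions).  No item is closed by this file.
-/

noncomputable section

-- the summit and its single sub-problem share the name (CONVENTIONS §1), as in every Theorems file
set_option linter.dupNamespace false

namespace Summit.NavierStokesRegularity.NavierStokesRegularity.Theorems.HalfSpaceWindowDoorCirculationCarryingRigidityGaussInflowLaw

open scoped BigOperators Topology MeasureTheory InnerProductSpace RealInnerProductSpace ContDiff
open Filter Set Function MeasureTheory Metric
open Literature.Analysis Literature.Analysis.FluidPDE Literature.Analysis.UnboundedOperators
open Summit.NavierStokesRegularity.NavierStokesRegularity.Theses.HalfSpaceWindowDoor
open Summit.NavierStokesRegularity.NavierStokesRegularity.Theorems.HalfSpaceWindowDoorCirculationCarryingRigidityDefs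
open Summit.NavierStokesRegularity.NavierStokesRegularity.Theorems.HalfSpaceWindowDoorCirculationCarryingRigidityGaussKernel
open Summit.NavierStokesRegularity.NavierStokesRegularity.Theorems.HalfSpaceWindowDoorCirculationCarryingRigidityGaussTilting
  (hasDerivAt_G_backward)
open Summit.NavierStokesRegularity.NavierStokesRegularity.Theorems.LocalSineTubeDoorProfileAlignedWindowRigidityAncient
  (bdd_of_hasTypeITimeDecay analyticOnNhd_slice)
open Summit.NavierStokesRegularity.NavierStokesRegularity.Theorems.PoloidalWindowDoorPoloidalWindowRigidityClassSpaceTimeRates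
  (exists_deriv_rate_of_class)
open Summit.NavierStokesRegularity.NavierStokesRegularity.Theorems.ChiralWindowDoorClassDerivDecay (exists_classical_of_class)

variable {v : ℝ → EuclideanSpace ℝ (Fin 3) → EuclideanSpace ℝ (Fin 3)}

/-! ### The inflow correlation as a heat-kernel integral -/

/-- `ℐ(t;x₀)[u] = (4π)^{3/2} ∫ G_t(x−x₀) ⟪x−x₀, u(x)⟫ g(x) dx` for `t > 0` (`g = angMom x₀ u`). -/
theorem gaussInflow_eq_integral_heatKernel {t : ℝ} (ht : 0 < t) (x₀ : EuclideanSpace ℝ (Fin 3))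
    (u : EuclideanSpace ℝ (Fin 3) → EuclideanSpace ℝ (Fin 3)) :
    gaussInflow t x₀ u = (4 * Real.pi) ^ ((3 : ℝ) / 2) * ∫ x, heatKernel t (x - x₀) * (⟪x - x₀, u x⟫ * angMom x₀ u x) := by
  unfold gaussInflow
  have hg : (fun x => gauss t x₀ x * (⟪x - x₀, u x⟫ * angMom x₀ u x)) =
      fun x => (4 * Real.pi * t) ^ ((3 : ℝ) / 2) * (heatKernel t (x - x₀) * (⟪x - x₀, u x⟫ * angMom x₀ u x)) := by
    funext x; rw [gauss_eq_heatKernel ht]; ring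
  rw [hg, integral_const_mul, ← mul_assoc, rpow_scale ht]

/-! ### The pointwise rate of `⟪x−x₀, v⟫·g` -/

/-- If `σ ↦ v(σ,x)` has rate `w` at `σ`, then `σ ↦ ⟪x−x₀, v(σ,x)⟫·g(σ,x)` has rate
`⟪x−x₀, w⟫·g + ⟪x−x₀, v⟫·((x−x₀)₀w₁ − (x−x₀)₁w₀)`. -/
theorem hasDerivAt_inner_mul_angMom {σ : ℝ} {x x₀ w : EuclideanSpace ℝ (Fin 3)} (hv : HasDerivAt (fun τ => v τ x) w σ) :
    HasDerivAt (fun τ => ⟪x - x₀, v τ x⟫ * angMom x₀ (v τ) x)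
      (⟪x - x₀, w⟫ * angMom x₀ (v σ) x + ⟪x - x₀, v σ x⟫ * ((x - x₀) 0 * w 1 - (x - x₀) 1 * w 0)) σ := by
  have h1 : HasDerivAt (fun τ => ⟪x - x₀, v τ x⟫) ⟪x - x₀, w⟫ σ := by
    have h := (hasDerivAt_const σ (x - x₀)).inner ℝ hv
    simpa using h
  have hc : ∀ i : Fin 3, HasDerivAt (fun τ => v τ x i) (w i) σ := fun i =>
    (EuclideanSpace.proj (𝕜 := ℝ) i).hasFDerivAt.comp_hasDerivAt σ hv
  have h2 : HasDerivAt (fun τ => angMom x₀ (v τ) x) ((x - x₀) 0 * w 1 - (x - x₀) 1 * w 0) σ := by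
    unfold angMom
    exact ((hc 1).const_mul ((x - x₀) 0)).sub ((hc 0).const_mul ((x - x₀) 1))
  exact h1.mul h2

/-! ### Differentiation under the Gaussian integral -/

/-- **KINEMATIC INFLOW LAW (moving backward heat-kernel window).**  For a jointly smooth field `v` on `(−∞,0) × ℝ³` with `v` and
`∂ₜv` uniformly bounded on a time neighbourhood of `s < 0`, and `s < s₀` (with the neighbourhood inside the half characteristic):
`σ ↦ ∫ G_{s₀−σ}(x−x₀) ⟪x−x₀, v(σ,x)⟫ g(σ,x) dx` is differentiable at `s`, with the derivative obtained by differentiating under the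
integral sign (`∂_σ G_{s₀−σ} = −(‖x−x₀‖²/4t² − 3/2t)G_{s₀−σ}`, `∂ₜv = timeDerivWithin (Iio 0) v`). -/
theorem hasDerivAt_gaussInflowIntegral_time (hu : IsSmoothSpaceTimeOn (Iio (0 : ℝ)) v) {s δ s₀ : ℝ} (hδ : 0 < δ)
    (hδs : s + δ < 0) (hδt : 2 * δ ≤ s₀ - s) {Bu Bt : ℝ}
    (hBu : ∀ σ ∈ Ioo (s - δ) (s + δ), ∀ x, ‖v σ x‖ ≤ Bu)
    (hBt : ∀ σ ∈ Ioo (s - δ) (s + δ), ∀ x, ‖timeDerivWithin (Iio (0 : ℝ)) v σ x‖ ≤ Bt) (x₀ : EuclideanSpace ℝ (Fin 3)) :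
    HasDerivAt (fun σ => ∫ x, heatKernel (s₀ - σ) (x - x₀) * (⟪x - x₀, v σ x⟫ * angMom x₀ (v σ) x))
      (∫ x, (-((‖x - x₀‖ ^ 2 / (4 * (s₀ - s) ^ 2) - (3 : ℝ) / (2 * (s₀ - s))) * heatKernel (s₀ - s) (x - x₀)) *
          (⟪x - x₀, v s x⟫ * angMom x₀ (v s) x) +
        heatKernel (s₀ - s) (x - x₀) *
          (⟪x - x₀, timeDerivWithin (Iio (0 : ℝ)) v s x⟫ * angMom x₀ (v s) x +
            ⟪x - x₀, v s x⟫ * ((x - x₀) 0 * timeDerivWithin (Iio (0 : ℝ)) v s x 1 -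
              (x - x₀) 1 * timeDerivWithin (Iio (0 : ℝ)) v s x 0)))) s := by
  have hs : s < 0 := by linarith
  have ht : 0 < s₀ - s := by linarith
  have hsI : s ∈ Ioo (s - δ) (s + δ) := ⟨by linarith, by linarith⟩
  have hIneg : ∀ σ ∈ Ioo (s - δ) (s + δ), σ < 0 := fun σ hσ => lt_trans hσ.2 hδs
  have hIs₀ : ∀ σ ∈ Ioo (s - δ) (s + δ), σ < s₀ := fun σ hσ => by linarith [hσ.2]
  have hIcc : ∀ σ ∈ Ioo (s - δ) (s + δ), s₀ - σ ∈ Icc ((s₀ - s) / 2) (2 * (s₀ - s)) := fun σ hσ =>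
    ⟨by linarith [hσ.2], by linarith [hσ.1]⟩
  have hS : UniqueDiffOn ℝ (Iio (0 : ℝ)) := isOpen_Iio.uniqueDiffOn
  set vd : ℝ → EuclideanSpace ℝ (Fin 3) → EuclideanSpace ℝ (Fin 3) := timeDerivWithin (Iio (0 : ℝ)) v with hvd
  have hvs : ∀ σ < (0 : ℝ), Continuous (v σ) := fun σ hσ => (hu.contDiff_slice hσ).continuous
  have hvd_smooth : IsSmoothSpaceTimeOn (Iio (0 : ℝ)) vd := hu.timeDerivWithin hS
  have hvds : ∀ σ < (0 : ℝ), Continuous (vd σ) := fun σ hσ => (hvd_smooth.contDiff_slice hσ).continuous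
  have hvdot : ∀ σ < (0 : ℝ), ∀ x, HasDerivAt (fun τ => v τ x) (vd σ x) σ := fun σ hσ x =>
    (hu.hasDerivWithinAt_timeDerivWithin hS hσ x).hasDerivAt (Iio_mem_nhds hσ)
  have hBu0 : 0 ≤ Bu := (norm_nonneg _).trans (hBu s hsI x₀)
  have hBt0 : 0 ≤ Bt := (norm_nonneg _).trans (hBt s hsI x₀)
  -- Gaussian majorants of the moving window and of its time derivative on `s₀ − σ ∈ [t/2, 2t]`
  obtain ⟨Ctw, hCtw0, hCtw⟩ := exists_abs_timeWeight_mul_heatKernel_le (E := EuclideanSpace ℝ (Fin 3)) ht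
  set A : ℝ := (4 * Real.pi * ((s₀ - s) / 2)) ^ (-(Module.finrank ℝ (EuclideanSpace ℝ (Fin 3)) : ℝ) / 2) with hA
  have hA0 : 0 ≤ A := by rw [hA]; positivity
  set gauss16 : EuclideanSpace ℝ (Fin 3) → ℝ := fun x => Real.exp (-(1 / (16 * (s₀ - s))) * ‖x - x₀‖ ^ 2) with hg16
  have hg16nn : ∀ x, 0 ≤ gauss16 x := fun x => (Real.exp_pos _).le
  -- `‖x−x₀‖² gauss16` is integrable: `gauss16 = (16πt)^{3/2} G_{4t}(· − x₀)`
  have hg16_eq : ∀ x, gauss16 x = (4 * Real.pi * (4 * (s₀ - s))) ^ ((3 : ℝ) / 2) * heatKernel (4 * (s₀ - s)) (x - x₀) := by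
    intro x
    have hpos : 0 < 4 * Real.pi * (4 * (s₀ - s)) := by positivity
    rw [heatKernel_eq, finrank_euclideanSpace_fin, ← mul_assoc, ← Real.rpow_add hpos]
    push_cast
    rw [show (3 : ℝ) / 2 + -(3 : ℝ) / 2 = 0 by ring, Real.rpow_zero, one_mul, hg16]
    field_simp
    ring
  have hmom2_int : Integrable (fun x => ‖x - x₀‖ ^ 2 * gauss16 x) := by
    have h := (integrable_norm_sq_mul_G x₀ (by positivity : 0 < 4 * (s₀ - s))).const_mul
      ((4 * Real.pi * (4 * (s₀ - s))) ^ ((3 : ℝ) / 2))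
    refine h.congr (ae_of_all _ fun x => ?_)
    simp only [hg16_eq x]; ring
  have hKle : ∀ σ ∈ Ioo (s - δ) (s + δ), ∀ x, heatKernel (s₀ - σ) (x - x₀) ≤ A * gauss16 x := by
    intro σ hσ x
    refine (heatKernel_le_of_mem_Icc (E := EuclideanSpace ℝ (Fin 3)) ht (hIcc σ hσ) (x - x₀)).trans ?_
    simp only [hg16, hA]
    refine mul_le_mul_of_nonneg_left (Real.exp_le_exp.2 ?_) (by positivity)
    have hn : 0 ≤ ‖x - x₀‖ ^ 2 := by positivity
    have h16 : (1 / (16 * (s₀ - s))) ≤ 1 / (8 * (s₀ - s)) := one_div_le_one_div_of_le (by positivity) (by linarith)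
    nlinarith
  have htwle : ∀ σ ∈ Ioo (s - δ) (s + δ), ∀ x,
      |(‖x - x₀‖ ^ 2 / (4 * (s₀ - σ) ^ 2) - (3 : ℝ) / (2 * (s₀ - σ))) * heatKernel (s₀ - σ) (x - x₀)| ≤ Ctw * gauss16 x := by
    intro σ hσ x
    have h := hCtw (s₀ - σ) (hIcc σ hσ) (x - x₀)
    rw [finrank_euclideanSpace_fin] at h
    push_cast at h
    rw [abs_mul, abs_of_nonneg (heatKernel_pos (by linarith [(hIcc σ hσ).1]) _).le]
    simpa only [hg16] using h
  -- pointwise bounds for the velocity factors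
  have hα : ∀ σ ∈ Ioo (s - δ) (s + δ), ∀ x, |⟪x - x₀, v σ x⟫| ≤ ‖x - x₀‖ * Bu := fun σ hσ x =>
    (abs_real_inner_le_norm _ _).trans (mul_le_mul_of_nonneg_left (hBu σ hσ x) (norm_nonneg _))
  have hγ : ∀ σ ∈ Ioo (s - δ) (s + δ), ∀ x, |angMom x₀ (v σ) x| ≤ 2 * ‖x - x₀‖ * Bu := fun σ hσ x =>
    (abs_angMom_le x₀ (v σ) x).trans (mul_le_mul_of_nonneg_left (hBu σ hσ x) (by positivity))
  have hαd : ∀ σ ∈ Ioo (s - δ) (s + δ), ∀ x, |⟪x - x₀, vd σ x⟫| ≤ ‖x - x₀‖ * Bt := fun σ hσ x =>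
    (abs_real_inner_le_norm _ _).trans (mul_le_mul_of_nonneg_left (hBt σ hσ x) (norm_nonneg _))
  have hγd : ∀ σ ∈ Ioo (s - δ) (s + δ), ∀ x, |(x - x₀) 0 * vd σ x 1 - (x - x₀) 1 * vd σ x 0| ≤ 2 * ‖x - x₀‖ * Bt :=
    fun σ hσ x => (abs_angMom_le x₀ (vd σ) x).trans (mul_le_mul_of_nonneg_left (hBt σ hσ x) (by positivity))
  -- the integrand, its derivative
  set F : ℝ → EuclideanSpace ℝ (Fin 3) → ℝ := fun σ x =>
    heatKernel (s₀ - σ) (x - x₀) * (⟪x - x₀, v σ x⟫ * angMom x₀ (v σ) x) with hF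
  set F' : ℝ → EuclideanSpace ℝ (Fin 3) → ℝ := fun σ x =>
    -((‖x - x₀‖ ^ 2 / (4 * (s₀ - σ) ^ 2) - (3 : ℝ) / (2 * (s₀ - σ))) * heatKernel (s₀ - σ) (x - x₀)) *
        (⟪x - x₀, v σ x⟫ * angMom x₀ (v σ) x) +
      heatKernel (s₀ - σ) (x - x₀) *
        (⟪x - x₀, vd σ x⟫ * angMom x₀ (v σ) x + ⟪x - x₀, v σ x⟫ * ((x - x₀) 0 * vd σ x 1 - (x - x₀) 1 * vd σ x 0)) with hF'
  -- continuity (hence measurability) of the integrands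
  have hcoord : ∀ i : Fin 3, Continuous fun x : EuclideanSpace ℝ (Fin 3) => (x - x₀) i := fun i =>
    (EuclideanSpace.proj (𝕜 := ℝ) i).continuous.comp (continuous_id.sub continuous_const)
  have hcomp : ∀ (w : EuclideanSpace ℝ (Fin 3) → EuclideanSpace ℝ (Fin 3)), Continuous w → ∀ i : Fin 3,
      Continuous fun x => w x i := fun w hw i => (EuclideanSpace.proj (𝕜 := ℝ) i).continuous.comp hw
  have hangMom_c : ∀ (w : EuclideanSpace ℝ (Fin 3) → EuclideanSpace ℝ (Fin 3)), Continuous w →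
      Continuous fun x => (x - x₀) 0 * w x 1 - (x - x₀) 1 * w x 0 := fun w hw =>
    ((hcoord 0).mul (hcomp w hw 1)).sub ((hcoord 1).mul (hcomp w hw 0))
  have hinner_c : ∀ (w : EuclideanSpace ℝ (Fin 3) → EuclideanSpace ℝ (Fin 3)), Continuous w →
      Continuous fun x => ⟪x - x₀, w x⟫ := fun w hw => (continuous_id.sub continuous_const).inner hw
  have hFc : ∀ σ < (0 : ℝ), Continuous (F σ) := by
    intro σ hσ
    simp only [hF, angMom]
    exact (continuous_G x₀ (s₀ - σ)).mul ((hinner_c _ (hvs σ hσ)).mul (hangMom_c _ (hvs σ hσ)))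
  have htwc : Continuous fun x : EuclideanSpace ℝ (Fin 3) =>
      -((‖x - x₀‖ ^ 2 / (4 * (s₀ - s) ^ 2) - (3 : ℝ) / (2 * (s₀ - s))) * heatKernel (s₀ - s) (x - x₀)) := by
    refine (Continuous.mul ?_ (continuous_G x₀ (s₀ - s))).neg
    fun_prop
  have hF'c : Continuous (F' s) := by
    simp only [hF', angMom]
    exact (htwc.mul ((hinner_c _ (hvs s hs)).mul (hangMom_c _ (hvs s hs)))).add
      ((continuous_G x₀ (s₀ - s)).mul (((hinner_c _ (hvds s hs)).mul (hangMom_c _ (hvs s hs))).add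
        ((hinner_c _ (hvs s hs)).mul (hangMom_c _ (hvds s hs)))))
  -- integrability of `F s`
  have hFint : Integrable (F s) := by
    refine (hmom2_int.const_mul (A * (2 * Bu * Bu))).mono' (hFc s hs).aestronglyMeasurable (ae_of_all _ fun x => ?_)
    simp only [hF]
    have hG := hKle s hsI x
    have hG0 : 0 ≤ heatKernel (s₀ - s) (x - x₀) := (heatKernel_pos ht _).le
    rw [norm_mul, norm_mul, Real.norm_of_nonneg hG0, Real.norm_eq_abs, Real.norm_eq_abs]
    calc heatKernel (s₀ - s) (x - x₀) * (|⟪x - x₀, v s x⟫| * |angMom x₀ (v s) x|)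
        ≤ (A * gauss16 x) * ((‖x - x₀‖ * Bu) * (2 * ‖x - x₀‖ * Bu)) :=
          mul_le_mul hG (mul_le_mul (hα s hsI x) (hγ s hsI x) (abs_nonneg _) (by positivity)) (by positivity) (by positivity)
      _ = A * (2 * Bu * Bu) * (‖x - x₀‖ ^ 2 * gauss16 x) := by ring
  -- the dominated-differentiation lemma
  have hball : ball s δ = Ioo (s - δ) (s + δ) := Real.ball_eq_Ioo s δ
  have hmeas : ∀ᶠ σ in 𝓝 s, AEStronglyMeasurable (F σ) volume := by
    filter_upwards [Iio_mem_nhds hs] with σ hσ using (hFc σ hσ).aestronglyMeasurable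
  set K : ℝ := Ctw * (2 * Bu * Bu) + A * (4 * Bu * Bt) with hK
  have hbound : ∀ᵐ x ∂(volume : Measure (EuclideanSpace ℝ (Fin 3))), ∀ σ ∈ ball s δ,
      ‖F' σ x‖ ≤ K * (‖x - x₀‖ ^ 2 * gauss16 x) := by
    refine ae_of_all _ fun x σ hσ => ?_
    rw [hball] at hσ
    simp only [hF']
    have hg0 := hg16nn x
    have hG0 : 0 ≤ heatKernel (s₀ - σ) (x - x₀) := (heatKernel_pos (by linarith [(hIcc σ hσ).1]) _).le
    have e1 : ‖-((‖x - x₀‖ ^ 2 / (4 * (s₀ - σ) ^ 2) - (3 : ℝ) / (2 * (s₀ - σ))) * heatKernel (s₀ - σ) (x - x₀)) *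
        (⟪x - x₀, v σ x⟫ * angMom x₀ (v σ) x)‖ ≤ (Ctw * gauss16 x) * ((‖x - x₀‖ * Bu) * (2 * ‖x - x₀‖ * Bu)) := by
      rw [norm_mul, norm_neg, Real.norm_eq_abs, norm_mul, Real.norm_eq_abs, Real.norm_eq_abs]
      exact mul_le_mul (htwle σ hσ x) (mul_le_mul (hα σ hσ x) (hγ σ hσ x) (abs_nonneg _) (by positivity))
        (by positivity) (by positivity)
    have e2 : ‖heatKernel (s₀ - σ) (x - x₀) *
        (⟪x - x₀, vd σ x⟫ * angMom x₀ (v σ) x + ⟪x - x₀, v σ x⟫ * ((x - x₀) 0 * vd σ x 1 - (x - x₀) 1 * vd σ x 0))‖ ≤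
        (A * gauss16 x) * ((‖x - x₀‖ * Bt) * (2 * ‖x - x₀‖ * Bu) + (‖x - x₀‖ * Bu) * (2 * ‖x - x₀‖ * Bt)) := by
      rw [norm_mul, Real.norm_of_nonneg hG0]
      refine mul_le_mul (hKle σ hσ x) ?_ (norm_nonneg _) (by positivity)
      refine (norm_add_le _ _).trans (add_le_add ?_ ?_)
      · rw [norm_mul, Real.norm_eq_abs, Real.norm_eq_abs]
        exact mul_le_mul (hαd σ hσ x) (hγ σ hσ x) (abs_nonneg _) (by positivity)
      · rw [norm_mul, Real.norm_eq_abs, Real.norm_eq_abs]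
        exact mul_le_mul (hα σ hσ x) (hγd σ hσ x) (abs_nonneg _) (by positivity)
    calc _ ≤ (Ctw * gauss16 x) * ((‖x - x₀‖ * Bu) * (2 * ‖x - x₀‖ * Bu)) +
          (A * gauss16 x) * ((‖x - x₀‖ * Bt) * (2 * ‖x - x₀‖ * Bu) + (‖x - x₀‖ * Bu) * (2 * ‖x - x₀‖ * Bt)) :=
          (norm_add_le _ _).trans (add_le_add e1 e2)
      _ = K * (‖x - x₀‖ ^ 2 * gauss16 x) := by rw [hK]; ring
  have hdiff : ∀ᵐ x ∂(volume : Measure (EuclideanSpace ℝ (Fin 3))), ∀ σ ∈ ball s δ,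
      HasDerivAt (fun σ' => F σ' x) (F' σ x) σ := by
    refine ae_of_all _ fun x σ hσ => ?_
    rw [hball] at hσ
    have h := (hasDerivAt_G_backward (hIs₀ σ hσ) (x - x₀)).mul (hasDerivAt_inner_mul_angMom (x₀ := x₀) (hvdot σ (hIneg σ hσ) x))
    simp only [hF, hF']
    exact h
  exact (hasDerivAt_integral_of_dominated_loc_of_deriv_le (μ := volume) (F := F) (F' := F') (x₀ := s)
    (s := ball s δ) (ball_mem_nhds s hδ) hmeas hFint hF'c.aestronglyMeasurable hbound
    (hmom2_int.const_mul _) hdiff).2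


/-! ### On the door class -/

/-- **KINEMATIC INFLOW LAW ON THE DOOR CLASS.**  For every profile of the route's Type-I ancient Oseen-mild class (bundled as
`InDoorClass C v`), every axis datum `(x₀, s₀)` and every `s < min(0, s₀)`, the inflow correlation along the backward characteristic,
`σ ↦ ℐ(s₀−σ; x₀)[v(σ)]`, is differentiable at `s`, with
`d/ds ℐ = (4π)^{3/2} ∫ [−(‖x−x₀‖²/4t² − 3/2t)G_t(x−x₀)·⟪x−x₀,v⟫g + G_t(x−x₀)·(⟪x−x₀,∂ₜv⟫g + ⟪x−x₀,v⟫((x−x₀)₀∂ₜv₁ − (x−x₀)₁∂ₜv₀))] dx`,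
`t = s₀ − s`, `∂ₜv(s,x) = deriv (v · x) s` (the class is classical: `exists_classical_of_class`; rates `‖v‖ ≤ C/√(−t)`,
`‖∂ₜv‖ ≤ K/((−t)√(−t))` of `…ClassSpaceTimeRates`; then `hasDerivAt_gaussInflowIntegral_time`).  On the class `∂ₜv = Δv − (v·∇)v − ∇p`
for the classical pressure `p` (`IsClassicalNSSolutionOn.momentum`), which is how the pressure enters the second-order condition at the
Gaussian-extremal point. -/
theorem hasDerivAt_gaussInflow_of_class {C : ℝ} (hv : InDoorClass C v) (x₀ : EuclideanSpace ℝ (Fin 3)) {s₀ s : ℝ} (hs : s < 0)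
    (hs₀ : s < s₀) :
    HasDerivAt (fun σ => gaussInflow (s₀ - σ) x₀ (v σ))
      ((4 * Real.pi) ^ ((3 : ℝ) / 2) *
        ∫ x, (-((‖x - x₀‖ ^ 2 / (4 * (s₀ - s) ^ 2) - (3 : ℝ) / (2 * (s₀ - s))) * heatKernel (s₀ - s) (x - x₀)) *
            (⟪x - x₀, v s x⟫ * angMom x₀ (v s) x) +
          heatKernel (s₀ - s) (x - x₀) *
            (⟪x - x₀, deriv (fun τ => v τ x) s⟫ * angMom x₀ (v s) x +
              ⟪x - x₀, v s x⟫ * ((x - x₀) 0 * deriv (fun τ => v τ x) s 1 - (x - x₀) 1 * deriv (fun τ => v τ x) s 0)))) s := by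
  obtain ⟨hrate, hcont, hmild, hdiv⟩ := hv
  obtain ⟨q, hcl⟩ := exists_classical_of_class hrate hcont hmild hdiv
  have hu : IsSmoothSpaceTimeOn (Iio (0 : ℝ)) v := hcl.smooth_velocity
  obtain ⟨Kt, hKt0, hKt⟩ := exists_deriv_rate_of_class hrate hcont hmild
  have hC0 : 0 ≤ C := by
    have h := hrate (-1) (by norm_num) 0
    rw [neg_neg, Real.sqrt_one, div_one] at h
    exact (norm_nonneg _).trans h
  -- the neighbourhood `(s − δ, s + δ)`, `δ = min(−s/2, (s₀−s)/2)`, on which `−σ ≥ m := −s/2`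
  set δ : ℝ := min (-s / 2) ((s₀ - s) / 2) with hδ
  have hδ0 : 0 < δ := by rw [hδ]; exact lt_min (by linarith) (by linarith)
  have hδ1 : δ ≤ -s / 2 := min_le_left _ _
  have hδ2 : δ ≤ (s₀ - s) / 2 := min_le_right _ _
  have hδs : s + δ < 0 := by linarith
  have hδt : 2 * δ ≤ s₀ - s := by linarith
  set m : ℝ := -s / 2 with hm
  have hm0 : 0 < m := by rw [hm]; linarith
  have hms : ∀ σ ∈ Ioo (s - δ) (s + δ), m ≤ -σ ∧ σ < 0 := fun σ hσ => ⟨by rw [hm]; linarith [hσ.2], by linarith [hσ.2]⟩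
  -- time derivative within the open slab = plain derivative
  have htd : ∀ σ < (0 : ℝ), ∀ x, timeDerivWithin (Iio (0 : ℝ)) v σ x = deriv (fun τ => v τ x) σ := fun σ hσ x => by
    rw [timeDerivWithin, derivWithin_of_isOpen isOpen_Iio hσ]
  -- uniform bounds on the neighbourhood
  have hBu : ∀ σ ∈ Ioo (s - δ) (s + δ), ∀ x, ‖v σ x‖ ≤ C / Real.sqrt m := by
    intro σ hσ x
    obtain ⟨hle, hσ0⟩ := hms σ hσ
    exact (hrate σ hσ0 x).trans (div_le_div_of_nonneg_left hC0 (Real.sqrt_pos.2 hm0) (Real.sqrt_le_sqrt hle))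
  have hBt : ∀ σ ∈ Ioo (s - δ) (s + δ), ∀ x, ‖timeDerivWithin (Iio (0 : ℝ)) v σ x‖ ≤ Kt / (m * Real.sqrt m) := by
    intro σ hσ x
    obtain ⟨hle, hσ0⟩ := hms σ hσ
    rw [htd σ hσ0 x]
    refine (hKt σ hσ0 x).trans (div_le_div_of_nonneg_left hKt0 (by positivity) ?_)
    exact mul_le_mul hle (Real.sqrt_le_sqrt hle) (Real.sqrt_nonneg _) (by linarith)
  have hI := hasDerivAt_gaussInflowIntegral_time hu hδ0 hδs hδt hBu hBt x₀
  -- `ℐ(s₀−σ) = (4π)^{3/2} ∫ …` near `s`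
  have heq : (fun σ => gaussInflow (s₀ - σ) x₀ (v σ)) =ᶠ[𝓝 s]
      fun σ => (4 * Real.pi) ^ ((3 : ℝ) / 2) * ∫ x, heatKernel (s₀ - σ) (x - x₀) * (⟪x - x₀, v σ x⟫ * angMom x₀ (v σ) x) := by
    filter_upwards [Iio_mem_nhds hs₀] with σ hσ
    exact gaussInflow_eq_integral_heatKernel (by linarith [mem_Iio.1 hσ]) x₀ (v σ)
  have h := (hI.const_mul ((4 * Real.pi) ^ ((3 : ℝ) / 2))).congr_of_eventuallyEq heq
  simp only [htd s hs] at h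
  exact h

end Summit.NavierStokesRegularity.NavierStokesRegularity.Theorems.HalfSpaceWindowDoorCirculationCarryingRigidityGaussInflowLaw

end
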